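import Summits.RiemannHypothesis.RiemannHypothesis.Theorems.WeilArchPanelsN100ENe100v1D
import HarnessLib

/-!
# G3 A-layer data: panel certificates — window vector `ne100v1` (`v(x) = P(x/b)`, b = 1, 30 panels)

Generated by `cert/abgen/panels.py` (prover A g12 cellgen; run by prover A g23 for the cell-12 U-side at b = 1; dyadic penalty polynomial in `y = x/b`).
Kernel-checked by `decide +kernel`, each theorem a few seconds. [folklore]
-/

set_option linter.dupNamespace false

namespace Summit.RiemannHypothesis.RiemannHypothesis.Theorems.EvenWinsBeyondArch.ArchN100E

open Literature.NumberTheory.LFunctions Literature.Analysis.ValidatedNumerics.PolyMP Literature.Analysis.ValidatedNumerics.NumericsMP Literature.Analysis.ValidatedNumerics.ExpPoly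

set_option maxHeartbeats 0 in
/-- panel 6. [folklore] -/
theorem ne100v1_pc6 : archPanelCheck 1298074214633706907132624082305024 (1 / 30) 22 14 48 5 20 4 6 (ne100v1Qs.getD 6 []) 1024 (ne100v1ps.getD 6 []) ne100v1E ((1 : ℚ)) (ne100v1Ilo.getD 6 0) (ne100v1Ihi.getD 6 0) = true := by decide +kernel

set_option maxHeartbeats 0 in
/-- panel 7. [folklore] -/
theorem ne100v1_pc7 : archPanelCheck 1298074214633706907132624082305024 (1 / 30) 22 14 48 5 20 4 7 (ne100v1Qs.getD 7 []) 1024 (ne100v1ps.getD 7 []) ne100v1E ((1 : ℚ)) (ne100v1Ilo.getD 7 0) (ne100v1Ihi.getD 7 0) = true := by decide +kernel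

set_option maxHeartbeats 0 in
/-- panel 8. [folklore] -/
theorem ne100v1_pc8 : archPanelCheck 1298074214633706907132624082305024 (1 / 30) 22 14 48 5 20 4 8 (ne100v1Qs.getD 8 []) 1024 (ne100v1ps.getD 8 []) ne100v1E ((1 : ℚ)) (ne100v1Ilo.getD 8 0) (ne100v1Ihi.getD 8 0) = true := by decide +kernel

set_option maxHeartbeats 0 in
/-- panel 9. [folklore] -/
theorem ne100v1_pc9 : archPanelCheck 1298074214633706907132624082305024 (1 / 30) 22 14 48 5 20 4 9 (ne100v1Qs.getD 9 []) 1024 (ne100v1ps.getD 9 []) ne100v1E ((1 : ℚ)) (ne100v1Ilo.getD 9 0) (ne100v1Ihi.getD 9 0) = true := by decide +kernel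

set_option maxHeartbeats 0 in
/-- panel 10. [folklore] -/
theorem ne100v1_pc10 : archPanelCheck 1298074214633706907132624082305024 (1 / 30) 22 14 48 5 20 4 10 (ne100v1Qs.getD 10 []) 1024 (ne100v1ps.getD 10 []) ne100v1E ((1 : ℚ)) (ne100v1Ilo.getD 10 0) (ne100v1Ihi.getD 10 0) = true := by decide +kernel

set_option maxHeartbeats 0 in
/-- panel 11. [folklore] -/
theorem ne100v1_pc11 : archPanelCheck 1298074214633706907132624082305024 (1 / 30) 22 14 48 5 20 4 11 (ne100v1Qs.getD 11 []) 1024 (ne100v1ps.getD 11 []) ne100v1E ((1 : ℚ)) (ne100v1Ilo.getD 11 0) (ne100v1Ihi.getD 11 0) = true := by decide +kernel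

end Summit.RiemannHypothesis.RiemannHypothesis.Theorems.EvenWinsBeyondArch.ArchN100E
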